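import Literature.Probability.LatticeModels.ProdBernoulliIndependence
import HarnessLib

/-!
# Nolin's generalised FKG inequality for inhomogeneous product Bernoulli measures
# (`prodBernoulli p`, hence the canonical measure `P_G` of an isoradial graph)

Topic `Literature/Probability/LatticeModels`; proofs-only companion (no definition, no named fact)
of `ProdBernoulliIndependence` (Harris' inequality and cylinder calculus for
`prodBernoulli p`, the product of Bernoulli laws with coordinate-dependent parameters
`p : ι → [0, 1]`) and of `Literature.Probability.Percolation.LocallyMonotoneFKG` /
`BondLocallyMonotoneFKG` (Nolin's generalised FKG inequality for `Measure.infinitePi`, for site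
percolation and for the *homogeneous* bond measure `bondPercolation G p`).

The inequality (P. Nolin, *Near-critical percolation in two dimensions*, EJP 13 (2008), §4.3,
Lemma 13 = Lemma 12 of arXiv:0711.4948): "Consider `A⁺, Ã⁺` two increasing events, and `A⁻, Ã⁻`
two decreasing events. Assume that there exist three disjoint finite sets of vertices `𝒜`, `𝒜⁺`
and `𝒜⁻` such that `A⁺, A⁻, Ã⁺` and `Ã⁻` depend only on the sites in, respectively, `𝒜 ∪ 𝒜⁺`,
`𝒜 ∪ 𝒜⁻`, `𝒜⁺` and `𝒜⁻`. Then we have `P̂(Ã⁺ ∩ Ã⁻ | A⁺ ∩ A⁻) ≥ P̂(Ã⁺) P̂(Ã⁻)` for any product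
measure `P̂`." It is Kesten's "extended Harris–FKG inequality" (H. Kesten, *Scaling relations for
2D-percolation*, CMP 109 (1987), Lemma 3), the gluing tool of every arm-extension /
arm-separation argument involving arms of both colours. Here it is recorded for the
**inhomogeneous** product measure `prodBernoulli p` on `Set ι` — transported from
`infinitePi_locallyMonotone_fkg` along `MeasurableEquiv.setOf` exactly as `prodBernoulli_harris`
— and specialised to the canonical critical bond measure
`RhombicEmbedding.isoradialPercolation emb = prodBernoulli emb.edgeWeight` of an isoradially
embedded graph, which is NOT of the form `bondPercolation G p` (the edge weights
`p_e = criticalWeight (halfAngle e)` vary with the rhombus angles).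

Purpose. Grimmett–Manolescu, *Bond percolation on isoradial graphs*, PTRF 159 (2014) =
arXiv:1204.0505, prove the arm-exponent comparability Prop. 8.1 (`exp_transport`; the tree's
named facts `GrimmettManolescu2014_armComparability_one_two`, `k ∈ {1, 2}`, and
`GrimmettManolescu2014_altArmComparability`, `k = 2j ≥ 4`) through Prop. 8.2 (`exp_equiv`),
whose proof (§8.5.2) glues increasing (open) and decreasing (dual-open) pieces living in
overlapping regions: "By the extended Harris–FKG inequality of [Kesten87] (see also [Nolin]),
`P_G(H_M ∩ K_m ∩ A_k^{J,J}(M,m)) ≥ P_G(H_M) P_G(K_m) P_G[A_k^{J,J}(M,m)]`", and likewise for the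
omitted proofs of (exp_equiv_a), (exp_equiv_b) ("essentially that of [Nolin]"). For `k ≥ 2`
the events involved are neither increasing nor decreasing, so plain Harris
(`prodBernoulli_harris`, used for one arm in `IsoradialArmExtension`) does not suffice; this
file supplies the inequality those steps invoke, for the measure `P_G` they invoke it with.

## Contents (all proved)

* `prodBernoulli_locallyMonotone_fkg` — for pairwise disjoint finite `S, P, M ⊆ ι`, `A⁺`
  increasing determined by `S ∪ P`, `A⁻` decreasing determined by `S ∪ M`, `Ã⁺` increasing
  determined by `P`, `Ã⁻` decreasing determined by `M`:
  `P(A⁺ ∩ A⁻) · P(Ã⁺) · P(Ã⁻) ≤ P((A⁺ ∩ A⁻) ∩ (Ã⁺ ∩ Ã⁻))` for `P = prodBernoulli p`;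
  `prodBernoulli_locallyMonotone_fkg_cond` — the printed conditional form;
  `prodBernoulli_locallyMonotone_fkg_of_finite` — the same with the three regions given as
  finite `Set`s.
* `RhombicEmbedding.isoradialPercolation_locallyMonotone_fkg` (+ `_cond`, `_of_finite`) — the
  specialisation to `P_G`.
* `RhombicEmbedding.isoradialPercolation_locallyMonotone_fkg_shells` — the form in which §8 uses
  it: the three regions are the sets of pairs of vertices drawn (by `z`) in three pairwise
  disjoint sup-norm shells `{a ≤ ‖·‖_∞ ≤ b}`, finite on the class of the facts (preconnected,
  isoradial rhombic tiling with BAP(ε): `RhombicEmbedding.finite_setOf_boxNorm_z_le` would do,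
  but to keep the import closure at `LatticeModels` level finiteness of the vertex boxes is
  taken as the hypothesis `hfin`).

## References

* P. Nolin, *Near-critical percolation in two dimensions*, Electron. J. Probab. 13 (2008)
  1562–1623, §4.3, Lemma 13 (arXiv:0711.4948, Lemma 12) [Nolin2008].
* H. Kesten, *Scaling relations for 2D-percolation*, Comm. Math. Phys. 109 (1987) 109–156,
  Lemma 3 (extended Harris–FKG) [Kesten1987Scaling].
* G. R. Grimmett, I. Manolescu, PTRF 159 (2014) 273–327 = arXiv:1204.0505, §8.5.2
  [GrimmettManolescu2014Isoradial].
* G. R. Grimmett, *Percolation*, 2nd ed. (1999), §1.3 (product measure), Thm. (2.4)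
  [GrimmettPercolation1999].
-/

noncomputable section

namespace Literature.Probability.LatticeModels

open MeasureTheory Measure ProbabilityTheory Set Literature.Probability.Percolation

variable {ι : Type*}

/-! ### The inequality for `prodBernoulli p` -/

/-- **Nolin's generalised FKG inequality for the inhomogeneous product Bernoulli measure
`prodBernoulli p`** (Nolin 2008, EJP Lemma 13 = arXiv Lemma 12, "for any product measure";
Kesten 1987, Lemma 3): for three pairwise disjoint finite sets of coordinates `S, P, M`, an
increasing event `A⁺` and a decreasing event `A⁻` determined by the coordinates in `S ∪ P`,
resp. `S ∪ M`, and an increasing event `Ã⁺` and a decreasing event `Ã⁻` determined by the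
coordinates in `P`, resp. `M`,
`P(A⁺ ∩ A⁻) · (P(Ã⁺) · P(Ã⁻)) ≤ P((A⁺ ∩ A⁻) ∩ (Ã⁺ ∩ Ã⁻))`. (Transport of
`infinitePi_locallyMonotone_fkg` along `setOf`, as `prodBernoulli_harris`.)
[cite: Nolin2008, §4.3, Lemma 13 (arXiv 0711.4948: Lemma 12)] -/
theorem prodBernoulli_locallyMonotone_fkg (p : ι → unitInterval) {S P M : Finset ι}
    (hSP : Disjoint S P) (hSM : Disjoint S M) (hPM : Disjoint P M)
    {Ap Am Bp Bm : Set (Set ι)}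
    (hAp : IsUpperSet Ap) (hAm : IsLowerSet Am) (hBp : IsUpperSet Bp) (hBm : IsLowerSet Bm)
    (dAp : DeterminedBy Ap (↑S ∪ ↑P)) (dAm : DeterminedBy Am (↑S ∪ ↑M))
    (dBp : DeterminedBy Bp ↑P) (dBm : DeterminedBy Bm ↑M) :
    (prodBernoulli p).real (Ap ∩ Am) *
        ((prodBernoulli p).real Bp * (prodBernoulli p).real Bm) ≤
      (prodBernoulli p).real (Ap ∩ Am ∩ (Bp ∩ Bm)) := by
  classical
  have hSP' : DeterminedBy Ap ↑(S ∪ P) := by simpa only [Finset.coe_union] using dAp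
  have hSM' : DeterminedBy Am ↑(S ∪ M) := by simpa only [Finset.coe_union] using dAm
  have hmono : Monotone fun q : ι → Prop => {i | q i} := fun _ _ h i (hi : _) => h i hi
  simp only [prodBernoulli_real_eq_infinitePi, Set.preimage_inter]
  exact infinitePi_locallyMonotone_fkg _ hSP hSM hPM (hAp.preimage hmono) (hAm.preimage hmono)
    (hBp.preimage hmono) (hBm.preimage hmono) (measurable_setOf hSP'.measurableSet_of_finset)
    (measurable_setOf hSM'.measurableSet_of_finset) (measurable_setOf dBp.measurableSet_of_finset)
    (measurable_setOf dBm.measurableSet_of_finset) dAp dAm dBp dBm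

/-- **Conditional form** (as printed by Nolin, "`P̂(Ã⁺ ∩ Ã⁻ | A⁺ ∩ A⁻) ≥ P̂(Ã⁺) P̂(Ã⁻)`"): if
`P(A⁺ ∩ A⁻) > 0` then `P(Ã⁺) · P(Ã⁻) ≤ P((A⁺ ∩ A⁻) ∩ (Ã⁺ ∩ Ã⁻)) / P(A⁺ ∩ A⁻)`.
[cite: Nolin2008, §4.3, Lemma 13 (arXiv 0711.4948: Lemma 12)] -/
theorem prodBernoulli_locallyMonotone_fkg_cond (p : ι → unitInterval) {S P M : Finset ι}
    (hSP : Disjoint S P) (hSM : Disjoint S M) (hPM : Disjoint P M)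
    {Ap Am Bp Bm : Set (Set ι)}
    (hAp : IsUpperSet Ap) (hAm : IsLowerSet Am) (hBp : IsUpperSet Bp) (hBm : IsLowerSet Bm)
    (dAp : DeterminedBy Ap (↑S ∪ ↑P)) (dAm : DeterminedBy Am (↑S ∪ ↑M))
    (dBp : DeterminedBy Bp ↑P) (dBm : DeterminedBy Bm ↑M)
    (h0 : 0 < (prodBernoulli p).real (Ap ∩ Am)) :
    (prodBernoulli p).real Bp * (prodBernoulli p).real Bm ≤
      (prodBernoulli p).real (Ap ∩ Am ∩ (Bp ∩ Bm)) / (prodBernoulli p).real (Ap ∩ Am) := by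
  rw [le_div_iff₀ h0]
  have h := prodBernoulli_locallyMonotone_fkg p hSP hSM hPM hAp hAm hBp hBm dAp dAm dBp dBm
  nlinarith [h]

/-- The same inequality with the three regions given as pairwise disjoint **finite sets** of
coordinates. [cite: Nolin2008, §4.3, Lemma 13 (arXiv 0711.4948: Lemma 12)] -/
theorem prodBernoulli_locallyMonotone_fkg_of_finite (p : ι → unitInterval) {S P M : Set ι}
    (hS : S.Finite) (hP : P.Finite) (hM : M.Finite)
    (hSP : Disjoint S P) (hSM : Disjoint S M) (hPM : Disjoint P M)
    {Ap Am Bp Bm : Set (Set ι)}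
    (hAp : IsUpperSet Ap) (hAm : IsLowerSet Am) (hBp : IsUpperSet Bp) (hBm : IsLowerSet Bm)
    (dAp : DeterminedBy Ap (S ∪ P)) (dAm : DeterminedBy Am (S ∪ M))
    (dBp : DeterminedBy Bp P) (dBm : DeterminedBy Bm M) :
    (prodBernoulli p).real (Ap ∩ Am) *
        ((prodBernoulli p).real Bp * (prodBernoulli p).real Bm) ≤
      (prodBernoulli p).real (Ap ∩ Am ∩ (Bp ∩ Bm)) := by
  have h := prodBernoulli_locallyMonotone_fkg p (S := hS.toFinset) (P := hP.toFinset)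
    (M := hM.toFinset) (Ap := Ap) (Am := Am) (Bp := Bp) (Bm := Bm)
  simp only [Set.Finite.disjoint_toFinset, Set.Finite.coe_toFinset] at h
  exact h hSP hSM hPM hAp hAm hBp hBm dAp dAm dBp dBm

/-! ### The canonical measure of an isoradial graph -/

namespace RhombicEmbedding

variable {V F : Type*} {G : SimpleGraph V} (emb : RhombicEmbedding G F)

/-- **The extended Harris–FKG inequality for `P_G`** (Kesten 1987, Lemma 3; Nolin 2008, Lemma
13), the inequality invoked in Grimmett–Manolescu 2014, §8.5.2 ("By the extended Harris–FKG
inequality of [Kesten87]") for the canonical critical measure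
`P_G = emb.isoradialPercolation = prodBernoulli emb.edgeWeight`: for pairwise disjoint finite
sets of pairs `S, P, M`, `A⁺` increasing determined by `S ∪ P`, `A⁻` decreasing determined by
`S ∪ M`, `Ã⁺` increasing determined by `P`, `Ã⁻` decreasing determined by `M`,
`P_G(A⁺ ∩ A⁻) · (P_G(Ã⁺) · P_G(Ã⁻)) ≤ P_G((A⁺ ∩ A⁻) ∩ (Ã⁺ ∩ Ã⁻))`.
[cite: GrimmettManolescu2014Isoradial, §8.5.2 (extended Harris–FKG); Nolin2008 §4.3 Lemma 13; Kesten1987Scaling Lemma 3] -/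
theorem isoradialPercolation_locallyMonotone_fkg {S P M : Finset (Sym2 V)}
    (hSP : Disjoint S P) (hSM : Disjoint S M) (hPM : Disjoint P M)
    {Ap Am Bp Bm : Set (BondConfig V)}
    (hAp : IsUpperSet Ap) (hAm : IsLowerSet Am) (hBp : IsUpperSet Bp) (hBm : IsLowerSet Bm)
    (dAp : DeterminedBy Ap (↑S ∪ ↑P)) (dAm : DeterminedBy Am (↑S ∪ ↑M))
    (dBp : DeterminedBy Bp ↑P) (dBm : DeterminedBy Bm ↑M) :
    emb.isoradialPercolation.real (Ap ∩ Am) *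
        (emb.isoradialPercolation.real Bp * emb.isoradialPercolation.real Bm) ≤
      emb.isoradialPercolation.real (Ap ∩ Am ∩ (Bp ∩ Bm)) :=
  prodBernoulli_locallyMonotone_fkg emb.edgeWeight hSP hSM hPM hAp hAm hBp hBm dAp dAm dBp dBm

/-- Conditional form for `P_G`: if `P_G(A⁺ ∩ A⁻) > 0` then
`P_G(Ã⁺) · P_G(Ã⁻) ≤ P_G((A⁺ ∩ A⁻) ∩ (Ã⁺ ∩ Ã⁻)) / P_G(A⁺ ∩ A⁻)`.
[cite: Nolin2008, §4.3, Lemma 13 (arXiv 0711.4948: Lemma 12)] -/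
theorem isoradialPercolation_locallyMonotone_fkg_cond {S P M : Finset (Sym2 V)}
    (hSP : Disjoint S P) (hSM : Disjoint S M) (hPM : Disjoint P M)
    {Ap Am Bp Bm : Set (BondConfig V)}
    (hAp : IsUpperSet Ap) (hAm : IsLowerSet Am) (hBp : IsUpperSet Bp) (hBm : IsLowerSet Bm)
    (dAp : DeterminedBy Ap (↑S ∪ ↑P)) (dAm : DeterminedBy Am (↑S ∪ ↑M))
    (dBp : DeterminedBy Bp ↑P) (dBm : DeterminedBy Bm ↑M)
    (h0 : 0 < emb.isoradialPercolation.real (Ap ∩ Am)) :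
    emb.isoradialPercolation.real Bp * emb.isoradialPercolation.real Bm ≤
      emb.isoradialPercolation.real (Ap ∩ Am ∩ (Bp ∩ Bm)) /
        emb.isoradialPercolation.real (Ap ∩ Am) :=
  prodBernoulli_locallyMonotone_fkg_cond emb.edgeWeight hSP hSM hPM hAp hAm hBp hBm dAp dAm dBp
    dBm h0

/-- The inequality for `P_G` with the three regions given as pairwise disjoint finite sets of
pairs. [cite: Nolin2008, §4.3, Lemma 13 (arXiv 0711.4948: Lemma 12)] -/
theorem isoradialPercolation_locallyMonotone_fkg_of_finite {S P M : Set (Sym2 V)}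
    (hS : S.Finite) (hP : P.Finite) (hM : M.Finite)
    (hSP : Disjoint S P) (hSM : Disjoint S M) (hPM : Disjoint P M)
    {Ap Am Bp Bm : Set (BondConfig V)}
    (hAp : IsUpperSet Ap) (hAm : IsLowerSet Am) (hBp : IsUpperSet Bp) (hBm : IsLowerSet Bm)
    (dAp : DeterminedBy Ap (S ∪ P)) (dAm : DeterminedBy Am (S ∪ M))
    (dBp : DeterminedBy Bp P) (dBm : DeterminedBy Bm M) :
    emb.isoradialPercolation.real (Ap ∩ Am) *
        (emb.isoradialPercolation.real Bp * emb.isoradialPercolation.real Bm) ≤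
      emb.isoradialPercolation.real (Ap ∩ Am ∩ (Bp ∩ Bm)) :=
  prodBernoulli_locallyMonotone_fkg_of_finite emb.edgeWeight hS hP hM hSP hSM hPM hAp hAm hBp hBm
    dAp dAm dBp dBm

/-- Pair shells over disjoint norm windows are disjoint (a pair has a member). [folklore] -/
private theorem disjoint_pairShell (z : V → ℂ) {a₁ b₁ a₂ b₂ : ℝ} (h : b₁ < a₂ ∨ b₂ < a₁) :
    Disjoint {e : Sym2 V | ∀ v ∈ e, (z v).boxNorm ∈ Set.Icc a₁ b₁}
      {e : Sym2 V | ∀ v ∈ e, (z v).boxNorm ∈ Set.Icc a₂ b₂} := by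
  rw [Set.disjoint_left]
  intro e h₁ h₂
  induction e using Sym2.ind with
  | h x y =>
    have hx₁ := h₁ x (Sym2.mem_mk_left x y)
    have hx₂ := h₂ x (Sym2.mem_mk_left x y)
    rw [Set.mem_Icc] at hx₁ hx₂
    rcases h with h | h <;> linarith [hx₁.1, hx₁.2, hx₂.1, hx₂.2]

/-- A pair shell is finite as soon as the vertex box `{‖z ·‖_∞ ≤ b}` is finite. [folklore] -/
private theorem finite_pairShell (z : V → ℂ) {a b : ℝ} (hfin : {v : V | (z v).boxNorm ≤ b}.Finite) :
    {e : Sym2 V | ∀ v ∈ e, (z v).boxNorm ∈ Set.Icc a b}.Finite := by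
  classical
  refine (hfin.toFinset.sym2.finite_toSet).subset fun e he => ?_
  rw [Finset.mem_coe, Finset.mem_sym2_iff]
  intro v hv
  rw [Set.Finite.mem_toFinset, Set.mem_setOf_eq]
  exact (he v hv).2

/-- **The extended Harris–FKG inequality for `P_G`, shell form.** Let three sup-norm windows
`[a₁, b₁]`, `[a₂, b₂]`, `[a₃, b₃]` be pairwise disjoint and let the vertex boxes
`{‖z ·‖_∞ ≤ bᵢ}` be finite (true for every preconnected isoradial rhombic tiling with BAP(ε),
`RhombicEmbedding.finite_setOf_boxNorm_z_le`). If `A⁺` is increasing and determined by the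
pairs drawn in the first or second window, `A⁻` decreasing and determined by the pairs drawn
in the first or third, `Ã⁺` increasing determined by the pairs of the second and `Ã⁻`
decreasing determined by the pairs of the third, then
`P_G(A⁺ ∩ A⁻) · (P_G(Ã⁺) · P_G(Ã⁻)) ≤ P_G((A⁺ ∩ A⁻) ∩ (Ã⁺ ∩ Ã⁻))` — the form used when arms in
an annulus are extended by open box crossings on one side and dual-open ones elsewhere
(Grimmett–Manolescu 2014, §8.5.2, `P_G(H_M ∩ K_m ∩ A) ≥ P_G(H_M) P_G(K_m) P_G(A)`).
[cite: GrimmettManolescu2014Isoradial, §8.5.2 (extended Harris–FKG); Nolin2008 §4.3 Lemma 13] -/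
theorem isoradialPercolation_locallyMonotone_fkg_shells {a₁ b₁ a₂ b₂ a₃ b₃ : ℝ}
    (hfin : ∀ t : ℝ, {v : V | (emb.z v).boxNorm ≤ t}.Finite)
    (h₁₂ : b₁ < a₂ ∨ b₂ < a₁) (h₁₃ : b₁ < a₃ ∨ b₃ < a₁) (h₂₃ : b₂ < a₃ ∨ b₃ < a₂)
    {Ap Am Bp Bm : Set (BondConfig V)}
    (hAp : IsUpperSet Ap) (hAm : IsLowerSet Am) (hBp : IsUpperSet Bp) (hBm : IsLowerSet Bm)
    (dAp : DeterminedBy Ap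
      ({e : Sym2 V | ∀ v ∈ e, (emb.z v).boxNorm ∈ Set.Icc a₁ b₁} ∪
        {e : Sym2 V | ∀ v ∈ e, (emb.z v).boxNorm ∈ Set.Icc a₂ b₂}))
    (dAm : DeterminedBy Am
      ({e : Sym2 V | ∀ v ∈ e, (emb.z v).boxNorm ∈ Set.Icc a₁ b₁} ∪
        {e : Sym2 V | ∀ v ∈ e, (emb.z v).boxNorm ∈ Set.Icc a₃ b₃}))
    (dBp : DeterminedBy Bp {e : Sym2 V | ∀ v ∈ e, (emb.z v).boxNorm ∈ Set.Icc a₂ b₂})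
    (dBm : DeterminedBy Bm {e : Sym2 V | ∀ v ∈ e, (emb.z v).boxNorm ∈ Set.Icc a₃ b₃}) :
    emb.isoradialPercolation.real (Ap ∩ Am) *
        (emb.isoradialPercolation.real Bp * emb.isoradialPercolation.real Bm) ≤
      emb.isoradialPercolation.real (Ap ∩ Am ∩ (Bp ∩ Bm)) :=
  emb.isoradialPercolation_locallyMonotone_fkg_of_finite (finite_pairShell emb.z (hfin b₁))
    (finite_pairShell emb.z (hfin b₂)) (finite_pairShell emb.z (hfin b₃))
    (disjoint_pairShell emb.z h₁₂) (disjoint_pairShell emb.z h₁₃) (disjoint_pairShell emb.z h₂₃)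
    hAp hAm hBp hBm dAp dAm dBp dBm

end RhombicEmbedding

end Literature.Probability.LatticeModels

end
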